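/-
Copyright: the b2b-balaban cell (near-miss cell 7), T⁴-continuum fan-out; row NE7b ROUND-2 swarm, seat
t4-ne7b-formalise-leaf-05 gen 3 (row S6g′ INSTANCE of `t4/b2b-balaban-t4-ne7b-p1/LEAVES-NE7b.md`; finding
F-leaf05g3-1, route (α)).  Released under the licence of the surrounding project.
-/
import Summits.QuantumFields.BalabanUV.T4Continuum.Support.HistoryJoinsSortTwin

/-!
# The records-gas WEIGHT of the class representative is tail-order blind: `root`, `npAll`, `npNR`, `treeWt` of the
# sorted twin (row S6g′ INSTANCE, «INST-TWIN» part 2)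

Summits-side support leaf of the T⁴-continuum cell (rung (B)+1 on a FINITE torus only; NOT infinite volume, NOT the
mass gap, NOT the Clay statement; NOT a proof of the spine estimate NE7b).  Row NE7b, route «COUNT», row S6g′.
[folklore] recursion over the pedigree's steps on the lineage's own carriers; nothing is quoted from print, nothing
printed is asserted, no `[cite:]` tag, no `Prop` fact minted, no definition.

WHY.  In the exits the clause `relabel (shape ∘ sh) G′ = G` (member `G′` ↦ counted shape tree `G`) is used ONCE
(`LateMergersCount.treeShape_of_labelTH` ∕ `HistoryTreeShapeLE`: `rw [← hG, rootStep_relabel, treeWt_relabel_shapeH]`) —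
only to identify the ROOT STEP and the records-gas weight `treeWt ρ η θ PEv.step = ρ(root)·θ^{partnerAges}·npNR η` of
`G` with those of the member's shape tree.  Under route (α) of F-leaf05g3-1 (physics + cost on the realised member,
count on the sorted twin) the counted tree is the twin's shape tree `relabel shape (P.sortR.gen c)` while the member's
is `relabel shape (P.gen c)`; this file shows the two have the SAME root step, root label, `npAll`, `npNR` and `treeWt`
(leaf-10 gen 3's `rootStep_gen_sortR`∕`partnerAges_gen_sortR` give the first and the age factor).

WHAT.  §1 `npAll_chainMerge_const`, `npNR_chainMerge_of_head_le` (chain identities).  §2 **`root_gen_sortR`**,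
**`npAll_gen_sortR`**, **`npNR_gen_sortR`**, **`treeWt_gen_sortR`** (under `HeadOldest`), and the shape-tree forms
**`rootStep_shape_gen_sortR`**, **`treeWt_shape_gen_sortR`** — exactly the two equalities the weakened clause of route
(α) asks.

HONEST SCOPE.  Bookkeeping identities over OUR carriers; whether the exits' clause is weakened (route (α)) or the
twin is re-keyed «largest booked reach first» (route (β′)) is the owner's ruling R-f3′ — this file serves (α) and is
harmless under (β′).  Nothing of H3∕(B)∕BetaPertH touched; NE7b NOT proved.  HONEST DEPENDENCY (cell): continuum YM on
T⁴ ⇐ BetaPertH ∧ nine spine estimates (0/9 proved); BetaPertH ⇐ (D1) ∧ (D4) ∧ CAP+tail; G-an2-4 gates asym, D1 and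
NE2/3/4.  This file changes none of it.
-/

open Finset
open Literature.MathematicalPhysics.QuantumFieldTheory.Balaban1983to89
open T4PersistenceDictionary T4PartnerMultiplicity T4BranchingRecordsGas T4BankedInduction
open Summit.QuantumFields.BalabanUV.T4Continuum.HistoryJoins
open Summit.QuantumFields.BalabanUV.T4Continuum.HistoryGen
open Summit.QuantumFields.BalabanUV.T4Continuum.HistorySiblingEntropyBridge

namespace Summit.QuantumFields.BalabanUV.T4Continuum.HistoryJoinsSortTwin

noncomputable section

/-! ## §1 Node products along a chain -/

section Chain

variable {ε : Type*} (η : ε → ℝ)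

/-- the full node product along a chain with a CONSTANT merger label [folklore] -/
theorem npAll_chainMerge_const (l : ε) : ∀ (G : Gen ε) (Hs : List (Gen ε)),
    npAll η (chainMerge G Hs fun _ => l) = npAll η G * (Hs.map (npAll η)).prod * η l ^ Hs.length
  | _, [] => by simp
  | G, H :: Hs => by
      rw [chainMerge_cons, npAll_chainMerge_const l _ Hs, List.map_cons, List.prod_cons, List.length_cons,
        npAll_merge, pow_succ]
      ring

/-- the non-root node product along a HEAD-OLDEST chain with a constant merger label: the head's non-root product, the
tail members' FULL products, one `η l` per merger [folklore] -/
theorem npNR_chainMerge_of_head_le (l : ε) : ∀ (G : Gen ε) (Hs : List (Gen ε)),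
    (∀ H ∈ Hs, G.rootStep ≤ H.rootStep) →
      npNR η (chainMerge G Hs fun _ => l) = npNR η G * (Hs.map (npAll η)).prod * η l ^ Hs.length
  | _, [], _ => by simp
  | G, H :: Hs, hold => by
      have hGH : G.rootStep ≤ H.rootStep := hold H List.mem_cons_self
      have hroot : (Gen.merge G H l).rootStep = G.rootStep := by rw [Gen.rootStep_merge, min_eq_left hGH]
      rw [chainMerge_cons, npNR_chainMerge_of_head_le l _ Hs (fun H' h => by
        rw [hroot]; exact hold H' (List.mem_cons_of_mem _ h)), List.map_cons, List.prod_cons, List.length_cons,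
        npNR_merge, if_pos hGH, pow_succ]
      ring

/-- relabellings compose [folklore] -/
theorem relabel_relabel {δ κ : Type*} (f : ε → δ) (g : δ → κ) : ∀ G : Gen ε, relabel g (relabel f G) = relabel (g ∘ f) G
  | Gen.born _ _ => rfl
  | Gen.renew G e h => by rw [relabel_renew, relabel_renew, relabel_renew, relabel_relabel f g G]; rfl
  | Gen.merge X Y e => by
      rw [relabel_merge, relabel_merge, relabel_merge, relabel_relabel f g X, relabel_relabel f g Y]; rfl

end Chain

/-! ## §2 The sorted twin has the same root, node products and tree weight -/

section Twin

variable {α π : Type*} (P : Pedigree α π)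

/-- **THE ROOT LABEL IS TAIL-ORDER BLIND** (the head is first in both listings and oldest). [folklore] -/
theorem root_gen_sortR (hH : ∀ c, P.HeadOldest c) (c : α) : (P.sortR.gen c).root = (P.gen c).root := by
  have hpart : ∀ q ∈ P.parts c, (P.sortR.flatPart c q).root = (P.flatPart c q).root := by
    intro q hq
    rcases q with ⟨c', _ | _⟩ | ⟨d, x⟩
    · have hlt := P.step_lt c c' false hq
      exact root_gen_sortR hH c'
    · have hlt := P.step_lt c c' true hq
      simp only [Pedigree.flatPart, Pedigree.step_sortR, root_renew]
      exact root_gen_sortR hH c'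
    · rfl
  cases hps : P.parts c with
  | nil => rw [gen_eq_of_nil P hps, gen_eq_of_nil P.sortR (P.parts_sortR_of_nil hps)]; rfl
  | cons p ps =>
      have hPS := P.parts_sortR_of_cons hps
      have hperm := List.mergeSort_perm ps fun q q' => decide (P.keyR c q ≤ P.keyR c q')
      have hflat := P.headOldest_flat (hH c) hps
      have hflatS := P.sortR.headOldest_flat (headOldest_sortR P hH c) hPS
      rw [gen_eq_of_cons P hps, gen_eq_of_cons P.sortR hPS,
        show merL (P.step c) = fun _ => ((P.step c, 2, 0) : PEv) from rfl,
        show merL (P.sortR.step c) = fun _ => ((P.sortR.step c, 2, 0) : PEv) from rfl,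
        root_chainMerge_of_head_le _ _ _ (fun H hHm => by
          obtain ⟨q, hq, rfl⟩ := List.mem_map.1 hHm
          exact hflatS.1 q hq),
        root_chainMerge_of_head_le _ _ _ (fun H hHm => by
          obtain ⟨q, hq, rfl⟩ := List.mem_map.1 hHm
          exact hflat.1 q hq)]
      exact hpart p (by rw [hps]; exact List.mem_cons_self)
termination_by P.step c
decreasing_by all_goals exact hlt

/-- **THE FULL NODE PRODUCT IS TAIL-ORDER BLIND.** [folklore] -/
theorem npAll_gen_sortR (η : PEv → ℝ) (hH : ∀ c, P.HeadOldest c) (c : α) :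
    npAll η (P.sortR.gen c) = npAll η (P.gen c) :=
  letter_gen_sortR P (npAll η) (fun m e _ => m * η e) (fun G e h => npAll_renew η G e h)
    (fun s _ m => m.prod * η ((s, 2, 0) : PEv) ^ (Multiset.card m - 1))
    (fun s q₀ qs _ _ _ => by
      rw [show merL s = fun _ => ((s, 2, 0) : PEv) from rfl, npAll_chainMerge_const]
      simp [mul_assoc]) hH c

/-- **THE NON-ROOT NODE PRODUCT IS TAIL-ORDER BLIND** under «oldest line first». [folklore] -/
theorem npNR_gen_sortR (η : PEv → ℝ) (hH : ∀ c, P.HeadOldest c) (c : α) :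
    npNR η (P.sortR.gen c) = npNR η (P.gen c) := by
  have hpart : ∀ q ∈ P.parts c, npNR η (P.sortR.flatPart c q) = npNR η (P.flatPart c q) := by
    intro q hq
    rcases q with ⟨c', _ | _⟩ | ⟨d, x⟩
    · have hlt := P.step_lt c c' false hq
      exact npNR_gen_sortR η hH c'
    · have hlt := P.step_lt c c' true hq
      simp only [Pedigree.flatPart, Pedigree.step_sortR, npNR_renew]
      rw [npNR_gen_sortR η hH c']
    · rfl
  have hall : ∀ q ∈ P.parts c, npAll η (P.sortR.flatPart c q) = npAll η (P.flatPart c q) := by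
    intro q hq
    rcases q with ⟨c', _ | _⟩ | ⟨d, x⟩
    · exact npAll_gen_sortR P η hH c'
    · simp only [Pedigree.flatPart, Pedigree.step_sortR, npAll_renew]
      rw [npAll_gen_sortR P η hH c']
    · rfl
  cases hps : P.parts c with
  | nil => rw [gen_eq_of_nil P hps, gen_eq_of_nil P.sortR (P.parts_sortR_of_nil hps)]; rfl
  | cons p ps =>
      have hPS := P.parts_sortR_of_cons hps
      have hperm := List.mergeSort_perm ps fun q q' => decide (P.keyR c q ≤ P.keyR c q')
      have hflat := P.headOldest_flat (hH c) hps
      have hflatS := P.sortR.headOldest_flat (headOldest_sortR P hH c) hPS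
      rw [gen_eq_of_cons P hps, gen_eq_of_cons P.sortR hPS,
        show merL (P.step c) = fun _ => ((P.step c, 2, 0) : PEv) from rfl,
        show merL (P.sortR.step c) = fun _ => ((P.sortR.step c, 2, 0) : PEv) from rfl,
        npNR_chainMerge_of_head_le η _ _ _ (fun H hHm => by
          obtain ⟨q, hq, rfl⟩ := List.mem_map.1 hHm
          exact hflatS.1 q hq),
        npNR_chainMerge_of_head_le η _ _ _ (fun H hHm => by
          obtain ⟨q, hq, rfl⟩ := List.mem_map.1 hHm
          exact hflat.1 q hq),
        List.map_map, List.map_map, List.length_map, List.length_map, hperm.length_eq, Pedigree.step_sortR,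
        hpart p (by rw [hps]; exact List.mem_cons_self)]
      congr 2
      rw [List.map_congr_left fun q hq =>
        show (npAll η ∘ P.sortR.flatPart c) q = (npAll η ∘ P.flatPart c) q from
          hall q (by rw [hps]; exact List.mem_cons_of_mem _ (hperm.mem_iff.1 hq))]
      exact (hperm.map _).prod_eq
termination_by P.step c
decreasing_by all_goals exact hlt

/-- **THE RECORDS-GAS TREE WEIGHT IS TAIL-ORDER BLIND** under «oldest line first»:
`treeWt ρ η θ PEv.step (P.sortR.gen c) = treeWt ρ η θ PEv.step (P.gen c)`. [folklore] -/
theorem treeWt_gen_sortR (ρ η : PEv → ℝ) (θ : ℝ) (hH : ∀ c, P.HeadOldest c) (c : α) :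
    treeWt ρ η θ PEv.step (P.sortR.gen c) = treeWt ρ η θ PEv.step (P.gen c) := by
  rw [treeWt_eq, treeWt_eq, root_gen_sortR P hH, partnerAges_gen_sortR P hH, npNR_gen_sortR P η hH]

/-! ### The shape trees (the exits' class representatives `relabel shape ·`) -/

/-- the root step of the twin's shape tree [folklore] -/
theorem rootStep_shape_gen_sortR (hH : ∀ c, P.HeadOldest c) (c : α) :
    (relabel shape (P.sortR.gen c)).rootStep = (relabel shape (P.gen c)).rootStep := by
  rw [rootStep_relabel, rootStep_relabel, rootStep_gen_sortR P hH]

/-- **THE TREE WEIGHT OF THE TWIN'S SHAPE TREE IS THE MEMBER'S** — the second equality route (α) asks of the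
weakened identification clause. [folklore] -/
theorem treeWt_shape_gen_sortR (ρ η : PEv → ℝ) (θ : ℝ) (hH : ∀ c, P.HeadOldest c) (c : α) :
    treeWt ρ η θ PEv.step (relabel shape (P.sortR.gen c)) = treeWt ρ η θ PEv.step (relabel shape (P.gen c)) := by
  rw [treeWt_relabel shape ρ η θ (st := PEv.step) (fun e => step_shape e),
    treeWt_relabel shape ρ η θ (st := PEv.step) (fun e => step_shape e), treeWt_gen_sortR P _ _ θ hH]

/-- the same with the tagged member on the right: `relabel (shape ∘ Prod.fst) (P.genT c)` is the member's shape tree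
[folklore] -/
theorem treeWt_shape_gen_sortR_genT (ρ η : PEv → ℝ) (θ : ℝ) (hH : ∀ c, P.HeadOldest c) (c : α) :
    treeWt ρ η θ PEv.step (relabel shape (P.sortR.gen c)) =
      treeWt ρ η θ PEv.step (relabel (shape ∘ Prod.fst) (P.genT c)) := by
  rw [treeWt_shape_gen_sortR P ρ η θ hH, ← relabel_relabel, Pedigree.relabel_eq_gmap' Prod.fst (P.genT c)]
  rfl

/-- … and the root steps [folklore] -/
theorem rootStep_shape_gen_sortR_genT (hH : ∀ c, P.HeadOldest c) (c : α) :
    (relabel shape (P.sortR.gen c)).rootStep = (relabel (shape ∘ Prod.fst) (P.genT c)).rootStep := by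
  rw [rootStep_shape_gen_sortR P hH, ← relabel_relabel, Pedigree.relabel_eq_gmap' Prod.fst (P.genT c)]
  rfl

end Twin

end

end Summit.QuantumFields.BalabanUV.T4Continuum.HistoryJoinsSortTwin
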